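import Summits.QuantumFields.YangMills.Theorems.UnitScaleTiltProp7LatticeLocalisedMassT3
import Summits.QuantumFields.YangMills.Theorems.UnitScaleTiltProp7TrueLinSparseSupport
import HarnessLib

/-!
# Route `UnitScaleTilt`, crux K1 «MinimiserStabilityRegPr» (stmt-QuantumFields-19200), route-R E′ (A′)-on-Σ, P-A2 (β), row «(n3)₂-sym» = H2-1ˢ —
# N-line glue N4∕S: THE LEVEL-0 LOCALISED MASS INDEXED BY THE CENTRE CHAINS (✓ N4 `…LatticeLocalisedMassT3` read on w5 g8's ✓ N2′ chains ∕ support families,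
# in the socket letters of px21 g7's N6b `…N32SymLocalisedRow` and with w5-20520 g10's ✓ N5 level-sum summands `(L^{j+2}∕L^k)³`, `L^{2(j+1)}` as right-hand letters)

Cell `ym3-torus` (YM ladder rung R3 — continuum SU(2) YM₃ on T³ — a RUNG, NOT d = 4, NOT infinite volume, NOT a mass gap, NOT the Clay problem).
Width seat `ym-ust-20520-w3` gen 11 on the N-line namer px21 g7's NAMER WORD №3 (a) «w3-20520: N4∕S GO» (2026-08-29T09:00:25Z; socket text VERBATIM from there).
THEOREMS ONLY (0 `def`, 0 `sorry`); `--kind proof --supports stmt-QuantumFields-19200 --as helper`; count-neutral.  Nothing here proves `hN2s`, H2-1ˢ, (β),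
`hD`, the stub `stub_existenceMinimalOrbit`, the crux or any summit statement.

## The point
px21's ✓ N6a∕N6b bound the second-order remainder of the level ratios in `ℓ¹` by global masses plus the LEVEL-0 LOCALISED masses
`Σ_{z ∈ S^k_{j+1}} Σ_{b ∈ C^{j,z}_0} ‖Y b‖²` — the mass of a bond field `Y` on the finest torus inside the sup-balls of radius `L^{j+1} − 2` around the level-0 centres of the
sites `z` of the centre chain `S^k_{j+1}` (w5 g8 ✓`Prop7TorusCentreChains` ∕ ✓`Prop7TrueLinSparseSupport`, letters INLINE).  THIS FILE bounds that socket, uniformly in `j + 1 ≤ k`, by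
`2·(L^{j+2}∕L^k)³·Σ_b ‖Y b‖² + 26136·L^{2(j+1)}·Σ_b Σ_ν (‖Y(b + e_ν)‖ − ‖Y b‖)²` — the two right-hand letters being EXACTLY w5-20520 g10's ✓ N5 `row_R1`∕`row_R2` summands, and the
norm-gap sum being px13 g6's ✓ N4b letter.  Regime `j + 2 ≤ k`: ✓`sum_centres_eq` (chain sum = sum over `y : T^{(k)}` at the level-`(j+1)` centre of `y`) ∘ THE LABEL IDENTITY
`centreLabel_pow` («the level-0 centre of the level-`(j+1)` centre of `y` is `embIter k y`») ∘ ✓ N4 `sum_normSq_bond_le_localisedMass_normGap_T3` at `ρ := L^{j+1} − 2`, `t := 1`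
(`2(2ρ+1)³ ≤ 2(L^{j+2})³` by `L ≥ 3`; `2·13068·(ρ+1)² ≤ 26136·L^{2(j+1)}`).  Regime `j + 1 = k` (no room to localise — LOCATE «H2-1ˢ» §4 «the top level uses the whole block»):
✓`sum_sum_family_le` (`Σ_z Σ_{C^z_0} ≤ 2^d·Σ_b`, `2³ ≤ 2·L³`).

## What is proved (ns `…Theorems.Prop7LocalisedMassCentreChainsT3`)
* ★ `centreLabel_pow` — `(n·L^r + (L^r−1)∕2)·L^s + (L^s−1)∕2 = n·L^{r+s} + (L^{r+s}−1)∕2` (✓`centreLabel_succ` iterated),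
  ★ `centre_centre_eq_embIter` — for `y : Site P k`, `j + 1 ≤ k ≤ m + K`: the level-0 centre label of the level-`(j+1)` centre of `y`, cast to `ZMod (sitesPerDir 0)`, IS `(embIter k y) κ`.
* ★★★ **`sum_centres_sum_normSq_bond_le`** — THE N4∕S ROW (px21's socket VERBATIM, unreduced `j + 1 − 0` kept): for `{V} [SeminormedAddCommGroup V]`, `hd : P.d = 3`, `k ≤ m + K`, `j + 1 ≤ k`,
  `Y : PBond P 0 → V`:
  `Σ_{z ∈ univ.filter (fun w : Site P (j+1) ↦ ∀ κ, (w κ).val % L^(k−(j+1)) = (L^(k−(j+1)) − 1)∕2)} Σ_{b ∈ univ.filter (fun b : PBond P 0 ↦ ∀ κ, ((b.src κ − (((z κ).val·L^(j+1−0) + (L^(j+1−0) − 1)∕2 : ℕ) : ZMod (sitesPerDir 0))).valMinAbs).natAbs ≤ L^(j+1−0) − 2)} ‖Y b‖²`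
  `≤ 2·((L:ℝ)^(j+2) ∕ (L:ℝ)^k)³·Σ_b ‖Y b‖² + 26136·(L:ℝ)^(2(j+1))·Σ_b Σ_ν (‖Y ⟨b.src.shift ν, b.dir⟩‖ − ‖Y b‖)²`.
DEPENDENCE: absolute `2`, `26136 = 2·13068` (px18's constant at `t = 1`) and powers of `L` only; nothing reads `k − j` beyond the displayed powers, nor `K`, `n`, the member, `ε₀`.
HONEST: bookkeeping (a relabelled sum, one label identity, two numeric comparisons) over ✓ N4 ∕ ✓ N2′; nothing of H2-1ˢ's member knit (N6c) ∕ `hN2s` ∕ `hMcomb₂` ∕ (β) ∕ the crux is proved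
or claimed; rung R3 (YM₃ on T³), NOT d = 4, NOT infinite volume, NOT Clay; YM gap NOT proved.
References: M. Giaquinta, *Multiple integrals in the calculus of variations and nonlinear elliptic systems*, Princeton 1983 [Giaquinta1984] (Ch. III §1 pp.64–72);
T. Bałaban, CMP 96 (1984) 223–250 [Balaban1984PropagatorsII] ((1.9) p.226); CMP 95 (1984) 17–40 [Balaban1984PropagatorsI] ((1.6), (1.18) pp.18–20);
CMP 109 (1987) 249–301 [Balaban1987RG1] ((0.1) p.251: the torus lattices, centres of cubes).
-/

set_option autoImplicit false

noncomputable section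

open scoped BigOperators

namespace Summit.QuantumFields.YangMills.Theorems.Prop7LocalisedMassCentreChainsT3

open Literature.MathematicalPhysics.QuantumFieldTheory.Balaban1983to89
open B15DeterminingSets (embIter)
open Summit.QuantumFields.YangMills.Theorems.Prop7TorusCentreChains (sum_centres_eq centreLabel_succ centreLabel_lt embIter_eq_centre)
open Summit.QuantumFields.YangMills.Theorems.Prop7TrueLinSparseSupport (sum_sum_family_le)
open Summit.QuantumFields.YangMills.Theorems.Prop7LatticeLocalisedMassT3 (sum_normSq_bond_le_localisedMass_normGap_T3)
open Finset

variable {P : Params}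

/-! ## §1 Label arithmetic: the centre of a centre -/

/-- ★ **THE CENTRE-OF-A-CENTRE LABEL IDENTITY**: `(n·L^r + (L^r−1)∕2)·L^s + (L^s−1)∕2 = n·L^{r+s} + (L^{r+s}−1)∕2` — the level-0 centre of the level-`s` block whose own label is the
level-`s` centre `n·L^r + (L^r−1)∕2` is the centre of the `L^{r+s}`-block of `n` (✓`centreLabel_succ` iterated). [cite: Balaban1987RG1, (0.1) p.251–252] -/
theorem centreLabel_pow (P : Params) (n r : ℕ) : ∀ s : ℕ,
    (n * P.L ^ r + (P.L ^ r - 1) / 2) * P.L ^ s + (P.L ^ s - 1) / 2 = n * P.L ^ (r + s) + (P.L ^ (r + s) - 1) / 2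
  | 0 => by simp
  | s + 1 => by
    have h1 := centreLabel_succ P n (r + s)
    have h2 := centreLabel_succ P 0 s
    simp only [zero_mul, zero_add] at h2
    have ih := centreLabel_pow P n r s
    rw [show r + (s + 1) = (r + s) + 1 by omega, ← h1, ← ih, ← h2, pow_succ]
    ring

/-- ★ **THE LEVEL-0 CENTRE OF THE LEVEL-`(j+1)` CENTRE OF `y ∈ T^{(k)}` IS `embIter k y`** (w5 g8's chain letters: the level-`(j+1)` centre of `y` is the site of label
`y_κ·L^{k−(j+1)} + (L^{k−(j+1)}−1)∕2`, its family's level-0 centre label is `(·).val·L^{j+1} + (L^{j+1}−1)∕2`; lit `embIter` = centre convention, ✓`embIter_eq_centre`; `j + 1 ≤ k ≤ m + K`,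
no wrap by ✓`centreLabel_lt`). [cite: Balaban1987RG1, (0.1) p.251–252] -/
theorem centre_centre_eq_embIter {k j : ℕ} (hk : k ≤ P.m + P.K) (hjk : j + 1 ≤ k) (y : Site P k) (κ : Fin P.d) :
    ((((((((y κ).val * P.L ^ (k - (j + 1)) + (P.L ^ (k - (j + 1)) - 1) / 2 : ℕ)) : ZMod (P.sitesPerDir (j + 1)))).val * P.L ^ (j + 1) +
        (P.L ^ (j + 1) - 1) / 2 : ℕ)) : ZMod (P.sitesPerDir 0)) = embIter k y κ := by
  have hlt : (y κ).val * P.L ^ (k - (j + 1)) + (P.L ^ (k - (j + 1)) - 1) / 2 < P.sitesPerDir (j + 1) :=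
    centreLabel_lt P (i := j + 1) (r := k - (j + 1)) (by omega) (by rw [show j + 1 + (k - (j + 1)) = k by omega]; exact ZMod.val_lt (y κ))
  rw [ZMod.val_natCast, Nat.mod_eq_of_lt hlt, centreLabel_pow P ((y κ).val) (k - (j + 1)) (j + 1), show k - (j + 1) + (j + 1) = k by omega,
    embIter_eq_centre k hk y]

/-! ## §2 The N4∕S row -/

section Vector

variable {V : Type*} [SeminormedAddCommGroup V]

/-- ★★★ **THE N4∕S ROW — THE LEVEL-0 LOCALISED MASS INDEXED BY THE CENTRE CHAINS** (px21 g7 NAMER WORD №3 (a), socket text of N6b VERBATIM): for `P.d = 3`, `k ≤ m + K`,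
`j + 1 ≤ k`, any bond field `Y : T^{(0)}-bonds → V` (`V` seminormed),
`Σ_{z ∈ S^k_{j+1}} Σ_{b ∈ C^{j,z}_0} ‖Y b‖² ≤ 2·(L^{j+2}∕L^k)³·Σ_b ‖Y b‖² + 26136·L^{2(j+1)}·Σ_b Σ_ν (‖Y(b + e_ν)‖ − ‖Y b‖)²` — regime `j + 2 ≤ k` by ✓ N4 on the block fibres
(volume fraction `(2L^{j+1} − 3)³∕L^{3k} ≤ (L^{j+2}∕L^k)³`, `L ≥ 3`; small radius `L^{j+1} − 2`), regime `j + 1 = k` by the multiplicity count `2^3 ≤ 2·L³` (✓`sum_sum_family_le`).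
[folklore] [cite: Giaquinta1984, Ch. III §1 pp.65–72; Balaban1984PropagatorsII, (1.9) p.226; Balaban1984PropagatorsI, (1.18) p.20; Balaban1987RG1, (0.1) p.251] -/
theorem sum_centres_sum_normSq_bond_le (hd : P.d = 3) {k j : ℕ} (hk : k ≤ P.m + P.K) (hjk : j + 1 ≤ k) (Y : PBond P 0 → V) :
    ∑ z ∈ univ.filter (fun w : Site P (j + 1) => ∀ κ, (w κ).val % P.L ^ (k - (j + 1)) = (P.L ^ (k - (j + 1)) - 1) / 2),
        ∑ b ∈ univ.filter (fun b : PBond P 0 => ∀ κ, ((b.src κ -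
          (((z κ).val * P.L ^ (j + 1 - 0) + (P.L ^ (j + 1 - 0) - 1) / 2 : ℕ) : ZMod (P.sitesPerDir 0))).valMinAbs).natAbs ≤ P.L ^ (j + 1 - 0) - 2), ‖Y b‖ ^ 2
      ≤ 2 * ((P.L : ℝ) ^ (j + 2) / (P.L : ℝ) ^ k) ^ 3 * ∑ b, ‖Y b‖ ^ 2 +
          26136 * (P.L : ℝ) ^ (2 * (j + 1)) * ∑ b : PBond P 0, ∑ ν : Fin P.d, (‖Y ⟨b.src.shift ν, b.dir⟩‖ - ‖Y b‖) ^ 2 := by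
  classical
  have hL3 : 3 ≤ P.L := T4ReflectionCone.three_le_L P
  have hLr : (3 : ℝ) ≤ (P.L : ℝ) := by exact_mod_cast hL3
  have hL0 : (0 : ℝ) < (P.L : ℝ) := by linarith
  set M : ℝ := ∑ b : PBond P 0, ‖Y b‖ ^ 2 with hM
  set G : ℝ := ∑ b : PBond P 0, ∑ ν : Fin P.d, (‖Y ⟨b.src.shift ν, b.dir⟩‖ - ‖Y b‖) ^ 2 with hG
  have hM0 : 0 ≤ M := sum_nonneg fun _ _ => sq_nonneg _
  have hG0 : 0 ≤ G := sum_nonneg fun _ _ => sum_nonneg fun _ _ => sq_nonneg _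
  have hpow3 : (3 : ℝ) ≤ (P.L : ℝ) ^ (j + 1) := by
    calc (3 : ℝ) ≤ (P.L : ℝ) := hLr
      _ = (P.L : ℝ) ^ 1 := (pow_one _).symm
      _ ≤ (P.L : ℝ) ^ (j + 1) := pow_le_pow_right₀ (by linarith) (by omega)
  rcases Nat.lt_or_ge (j + 1) k with hlt | hge
  · /- regime `j + 2 ≤ k`: relabel the chain sum by the top sites, identify the balls, apply N4 at `ρ := L^{j+1} − 2`, `t := 1` -/
    set ρ : ℕ := P.L ^ (j + 1) - 2 with hρdef
    have hρpos : 3 ≤ P.L ^ (j + 1) := by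
      calc 3 ≤ P.L := hL3
        _ = P.L ^ 1 := (pow_one _).symm
        _ ≤ P.L ^ (j + 1) := Nat.pow_le_pow_right P.L_pos (by omega)
    have hρk : 2 * ρ + 1 ≤ P.L ^ k := by
      have h1 : 2 * ρ + 1 ≤ P.L ^ (j + 2) := by
        rw [pow_succ]
        have := Nat.mul_le_mul_left (P.L ^ (j + 1)) hL3
        omega
      exact h1.trans (Nat.pow_le_pow_right P.L_pos (by omega))
    -- the ball identification, per top site
    have hset : ∀ y : Site P k,
        (univ.filter (fun b : PBond P 0 => ∀ κ, ((b.src κ -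
          (((((((y κ).val * P.L ^ (k - (j + 1)) + (P.L ^ (k - (j + 1)) - 1) / 2 : ℕ)) : ZMod (P.sitesPerDir (j + 1)))).val * P.L ^ (j + 1 - 0) +
            (P.L ^ (j + 1 - 0) - 1) / 2 : ℕ) : ZMod (P.sitesPerDir 0))).valMinAbs).natAbs ≤ P.L ^ (j + 1 - 0) - 2)) =
        univ.filter (fun b : PBond P 0 => ∀ κ, ((b.src κ - (embIter k y) κ).valMinAbs).natAbs ≤ ρ) := by
      intro y
      simp only [Nat.sub_zero, centre_centre_eq_embIter hk hjk y, hρdef]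
    have e1 := sum_centres_eq (P := P) (i := j + 1) (l := k) hjk hk
      (fun z : Site P (j + 1) => ∑ b ∈ univ.filter (fun b : PBond P 0 => ∀ κ, ((b.src κ -
          (((z κ).val * P.L ^ (j + 1 - 0) + (P.L ^ (j + 1 - 0) - 1) / 2 : ℕ) : ZMod (P.sitesPerDir 0))).valMinAbs).natAbs ≤ P.L ^ (j + 1 - 0) - 2), ‖Y b‖ ^ 2)
    rw [e1]
    simp only []
    rw [sum_congr rfl fun y _ => by rw [hset y]]
    -- N4 at `t := 1`
    have h4 := sum_normSq_bond_le_localisedMass_normGap_T3 hd hk Y hρk one_pos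
    have hρr : (ρ : ℝ) = (P.L : ℝ) ^ (j + 1) - 2 := by
      rw [hρdef]; push_cast [Nat.cast_sub (by omega : 2 ≤ P.L ^ (j + 1))]; ring
    -- the two numeric comparisons
    have hA : (1 + (1 : ℝ)) * ((2 * (ρ : ℝ) + 1) ^ 3 / ((P.L : ℝ) ^ k) ^ 3) ≤ 2 * ((P.L : ℝ) ^ (j + 2) / (P.L : ℝ) ^ k) ^ 3 := by
      rw [div_pow, hρr]
      have hk0 : (0 : ℝ) < ((P.L : ℝ) ^ k) ^ 3 := by positivity
      have h1 : (2 * ((P.L : ℝ) ^ (j + 1) - 2) + 1) ^ 3 ≤ ((P.L : ℝ) ^ (j + 2)) ^ 3 := by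
        have h0 : 0 ≤ 2 * ((P.L : ℝ) ^ (j + 1) - 2) + 1 := by linarith
        have h2 : 2 * ((P.L : ℝ) ^ (j + 1) - 2) + 1 ≤ (P.L : ℝ) ^ (j + 2) := by
          have h3 : (P.L : ℝ) ^ (j + 1) * 3 ≤ (P.L : ℝ) ^ (j + 1) * (P.L : ℝ) :=
            mul_le_mul_of_nonneg_left hLr (by positivity)
          rw [show (P.L : ℝ) ^ (j + 2) = (P.L : ℝ) ^ (j + 1) * (P.L : ℝ) from pow_succ _ _]; linarith
        exact pow_le_pow_left₀ h0 h2 3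
      have := div_le_div_of_nonneg_right h1 hk0.le
      linarith
    have hB : (1 + (1 : ℝ)⁻¹) * 13068 * ((ρ : ℝ) + 1) ^ 2 ≤ 26136 * (P.L : ℝ) ^ (2 * (j + 1)) := by
      rw [hρr, inv_one]
      have h1 : ((P.L : ℝ) ^ (j + 1) - 2 + 1) ^ 2 ≤ ((P.L : ℝ) ^ (j + 1)) ^ 2 := by
        have h0 : 0 ≤ (P.L : ℝ) ^ (j + 1) - 2 + 1 := by linarith
        exact pow_le_pow_left₀ h0 (by linarith) 2
      have h2 : ((P.L : ℝ) ^ (j + 1)) ^ 2 = (P.L : ℝ) ^ (2 * (j + 1)) := by rw [← pow_mul, mul_comm]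
      rw [← h2]
      linarith
    calc _ ≤ (1 + (1 : ℝ)) * ((2 * (ρ : ℝ) + 1) ^ 3 / ((P.L : ℝ) ^ k) ^ 3) * M + (1 + (1 : ℝ)⁻¹) * 13068 * ((ρ : ℝ) + 1) ^ 2 * G := h4
      _ ≤ 2 * ((P.L : ℝ) ^ (j + 2) / (P.L : ℝ) ^ k) ^ 3 * M + 26136 * (P.L : ℝ) ^ (2 * (j + 1)) * G :=
          add_le_add (mul_le_mul_of_nonneg_right hA hM0) (mul_le_mul_of_nonneg_right hB hG0)
  · /- regime `j + 1 = k`: no localisation, the multiplicity count `2^3 ≤ 2·L³` -/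
    have hk1 : k = j + 1 := le_antisymm hge hjk
    subst hk1
    have hfam := sum_sum_family_le (P := P) (j := j) (i := 0) hk (Nat.zero_le j) (fun b => ‖Y b‖ ^ 2) (fun b => sq_nonneg _)
    have hsub : ∑ z ∈ univ.filter (fun w : Site P (j + 1) => ∀ κ, (w κ).val % P.L ^ (j + 1 - (j + 1)) = (P.L ^ (j + 1 - (j + 1)) - 1) / 2),
        ∑ b ∈ univ.filter (fun b : PBond P 0 => ∀ κ, ((b.src κ -
          (((z κ).val * P.L ^ (j + 1 - 0) + (P.L ^ (j + 1 - 0) - 1) / 2 : ℕ) : ZMod (P.sitesPerDir 0))).valMinAbs).natAbs ≤ P.L ^ (j + 1 - 0) - 2), ‖Y b‖ ^ 2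
        ≤ ∑ z : Site P (j + 1), ∑ b ∈ univ.filter (fun b : PBond P 0 => ∀ κ, ((b.src κ -
          (((z κ).val * P.L ^ (j + 1 - 0) + (P.L ^ (j + 1 - 0) - 1) / 2 : ℕ) : ZMod (P.sitesPerDir 0))).valMinAbs).natAbs ≤ P.L ^ (j + 1 - 0) - 2), ‖Y b‖ ^ 2 :=
      sum_le_sum_of_subset_of_nonneg (filter_subset _ _) fun z _ _ => sum_nonneg fun _ _ => sq_nonneg _
    have hd8 : (2 : ℝ) ^ P.d = 8 := by rw [hd]; norm_num
    have hA : (8 : ℝ) ≤ 2 * ((P.L : ℝ) ^ (j + 2) / (P.L : ℝ) ^ (j + 1)) ^ 3 := by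
      have hne : (P.L : ℝ) ^ (j + 1) ≠ 0 := by positivity
      have : (P.L : ℝ) ^ (j + 2) / (P.L : ℝ) ^ (j + 1) = (P.L : ℝ) := by
        rw [pow_succ, mul_comm, mul_div_assoc, div_self hne, mul_one]
      rw [this]
      have h27 : (27 : ℝ) ≤ (P.L : ℝ) ^ 3 := by
        have := pow_le_pow_left₀ (by norm_num : (0 : ℝ) ≤ 3) hLr 3
        norm_num at this
        exact this
      linarith
    calc _ ≤ ∑ z : Site P (j + 1), ∑ b ∈ univ.filter (fun b : PBond P 0 => ∀ κ, ((b.src κ -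
            (((z κ).val * P.L ^ (j + 1 - 0) + (P.L ^ (j + 1 - 0) - 1) / 2 : ℕ) : ZMod (P.sitesPerDir 0))).valMinAbs).natAbs ≤ P.L ^ (j + 1 - 0) - 2), ‖Y b‖ ^ 2 := hsub
      _ ≤ 2 ^ P.d * M := hfam
      _ = 8 * M := by rw [hd8]
      _ ≤ 2 * ((P.L : ℝ) ^ (j + 2) / (P.L : ℝ) ^ (j + 1)) ^ 3 * M := mul_le_mul_of_nonneg_right hA hM0
      _ ≤ 2 * ((P.L : ℝ) ^ (j + 2) / (P.L : ℝ) ^ (j + 1)) ^ 3 * M + 26136 * (P.L : ℝ) ^ (2 * (j + 1)) * G :=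
          le_add_of_nonneg_right (by positivity)

end Vector

end Summit.QuantumFields.YangMills.Theorems.Prop7LocalisedMassCentreChainsT3

end
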